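import Mathlib

/-!
# A smooth plateau function with an explicit `L¹` bound on its derivative

`exists_smooth_plateau`: for `η > 0` there is a smooth `S : ℝ → ℝ` with `0 ≤ S ≤ 1`, `S = 1` on
`[-η, η]`, `S = 0` off `(-3η, 3η)`, and `∫ |S'| ≤ 2`. Construction: `S(x) = ∫_{x-2η}^{x+2η} ρ` for a smooth
bump `ρ ≥ 0` of mass one supported in `(-η, η)` (Mathlib's `ContDiffBump.normed`), so that
`S' = ρ(· + 2η) - ρ(· - 2η)` exactly. The point of the `L¹` bound (uniform in `η`) is the control of
boundary pairings of holomorphic functions against `φ S(· - b)` when a test function `φ` is cut off near an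
exceptional boundary point `b` (`Literature/Analysis/Complex/StripWeakBoundaryExceptional.lean`).
-/

noncomputable section

namespace Literature.Analysis.Calculus

open Set Filter MeasureTheory intervalIntegral
open scoped Topology

/-- **Smooth plateau with `∫ |S'| ≤ 2`.** For `η > 0` there is a smooth `S : ℝ → ℝ`, `0 ≤ S ≤ 1`, equal to
`1` on `[-η, η]` and to `0` off `(-3η, 3η)`, whose derivative is integrable with `∫ |S'| ≤ 2`
(`S = ∫_{·-2η}^{·+2η} ρ` for a normed bump `ρ` supported in `(-η, η)`, `S' = ρ(· + 2η) - ρ(· - 2η)`).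
[folklore] -/
theorem exists_smooth_plateau {η : ℝ} (hη : 0 < η) :
    ∃ S : ℝ → ℝ, ContDiff ℝ (⊤ : ℕ∞) S ∧ (∀ x, 0 ≤ S x) ∧ (∀ x, S x ≤ 1) ∧
      (∀ x, |x| ≤ η → S x = 1) ∧ (∀ x, 3 * η ≤ |x| → S x = 0) ∧
      Continuous (deriv S) ∧ Integrable (deriv S) ∧ (∫ x, |deriv S x|) ≤ 2 := by
  let β : ContDiffBump (0:ℝ) := ⟨η / 2, η, by positivity, by linarith⟩
  set ρ : ℝ → ℝ := β.normed volume with hρ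
  have hρs : ContDiff ℝ (⊤ : ℕ∞) ρ := β.contDiff_normed
  have hρc : Continuous ρ := β.continuous_normed
  have hρ0 : ∀ t, 0 ≤ ρ t := fun t => β.nonneg_normed t
  have hρ1 : ∫ t, ρ t = 1 := β.integral_normed
  have hρi : Integrable ρ := β.integrable_normed
  have hρsupp : ∀ t, ρ t ≠ 0 → |t| < η := by
    intro t ht
    have : t ∈ Function.support ρ := ht
    rw [hρ, β.support_normed_eq] at this
    simpa using this
  -- the plateau and its primitive description
  set P : ℝ → ℝ := fun z => ∫ t in (0:ℝ)..z, ρ t with hP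
  set S : ℝ → ℝ := fun x => ∫ t in (x - 2 * η)..(x + 2 * η), ρ t with hS
  have hSP : ∀ x, S x = P (x + 2 * η) - P (x - 2 * η) := by
    intro x
    simp only [hS, hP]
    rw [integral_interval_sub_left (hρc.intervalIntegrable _ _) (hρc.intervalIntegrable _ _)]
  have hPd : ∀ z, HasDerivAt P (ρ z) z := fun z => (hρc.integral_hasStrictDerivAt 0 z).hasDerivAt
  have hSd : ∀ x, HasDerivAt S (ρ (x + 2 * η) - ρ (x - 2 * η)) x := by
    intro x
    have h1 : HasDerivAt (fun x => P (x + 2 * η)) (ρ (x + 2 * η)) x :=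
      HasDerivAt.comp_add_const x (2 * η) (hPd (x + 2 * η))
    have h2 : HasDerivAt (fun x => P (x - 2 * η)) (ρ (x - 2 * η)) x :=
      HasDerivAt.comp_sub_const x (2 * η) (hPd (x - 2 * η))
    have := h1.sub h2
    refine this.congr_of_eventuallyEq (Filter.Eventually.of_forall fun y => hSP y)
  have hderiv : deriv S = fun x => ρ (x + 2 * η) - ρ (x - 2 * η) := funext fun x => (hSd x).deriv
  have hSdiff : Differentiable ℝ S := fun x => (hSd x).differentiableAt
  have hSsmooth : ContDiff ℝ (⊤ : ℕ∞) S := by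
    rw [contDiff_infty_iff_deriv]
    refine ⟨hSdiff, ?_⟩
    rw [hderiv]
    exact (hρs.comp (contDiff_id.add contDiff_const)).sub (hρs.comp (contDiff_id.sub contDiff_const))
  have h4η : ∀ x : ℝ, x - 2 * η ≤ x + 2 * η := fun x => by linarith
  refine ⟨S, hSsmooth, fun x => ?_, fun x => ?_, fun x hx => ?_, fun x hx => ?_, ?_, ?_, ?_⟩
  · exact intervalIntegral.integral_nonneg (h4η x) fun t _ => hρ0 t
  · simp only [hS]
    rw [integral_of_le (h4η x), ← hρ1]
    exact setIntegral_le_integral hρi (Filter.Eventually.of_forall hρ0)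
  · simp only [hS]
    rw [← hρ1]
    apply integral_eq_integral_of_support_subset
    intro t ht
    have := hρsupp t ht
    have h1 := (abs_lt.mp this)
    have h2 := abs_le.mp hx
    exact ⟨by linarith, by linarith⟩
  · simp only [hS]
    rw [intervalIntegral.integral_congr (g := fun _ => (0:ℝ)) fun t ht => ?_]
    · simp
    · rw [uIcc_of_le (h4η x)] at ht
      by_contra h
      have := hρsupp t h
      have h1 := (abs_lt.mp this)
      rcases le_abs.mp hx with h2 | h2 <;> linarith [ht.1, ht.2]
  · rw [hderiv]; fun_prop
  · rw [hderiv]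
    exact (hρi.comp_add_right _).sub (hρi.comp_sub_right _)
  · rw [hderiv]
    have hi1 : Integrable fun x => ρ (x + 2 * η) := hρi.comp_add_right _
    have hi2 : Integrable fun x => ρ (x - 2 * η) := hρi.comp_sub_right _
    calc (∫ x, |ρ (x + 2 * η) - ρ (x - 2 * η)|)
        ≤ ∫ x, (ρ (x + 2 * η) + ρ (x - 2 * η)) := by
          refine integral_mono (hi1.sub hi2).abs (hi1.add hi2) fun x => ?_
          have h1 := hρ0 (x + 2 * η); have h2 := hρ0 (x - 2 * η)
          simp only
          rw [abs_le]; constructor <;> linarith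
      _ = 2 := by
          rw [integral_add hi1 hi2, integral_add_right_eq_self (μ := volume) ρ,
            integral_sub_right_eq_self (μ := volume) ρ, hρ1]; norm_num

end Literature.Analysis.Calculus
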